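import Summits.QuantumFields.BalabanUV.Beta.GAN24.DressedLegEnvelope
import Summits.QuantumFields.BalabanUV.Beta.RemainderExplicitLaplacian

/-!
# `BalabanUV.Beta.GAN24.ContactPartnerLetters` — binder row G-an2-4 / (CONV-C), the row owner's CONTACT-TERM ROUTE (`gen18/CT3-MECHANISM.md` v1.1 §1(c), §(c)),
# CT-3c analysis, THE PARTNER LETTERS AT THE VERTEX LEVEL `m = 0`: the UNDRESSED one-shot leg `B μ z = respStep 1 N μ z` (= the translated `wH`-column,
# `RespStepDecay.respStep_one`) has its MAXWELL OPERATOR EQUAL TO THE TRANSLATED TENT FORCE `𝒬ᵀ_N φ_z` of the multiplier column (an5's gauge-free EL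
# `ResolventComposition.wH_EL'`), with the level-uniform envelopes of d4-p3's road-P3 menu I1 ∕ I2 TRANSLATED to the source block `z`; and the DRESSED
# composite leg `T μ z = legChain (respStepBmSeq ρ Lc) 0 k μ z` has THE SAME Maxwell operator (leaf-03 g51's §10 p271047 at the point datum).

NOT IN PRINT; OUR BOOKKEEPING (G-an2-4 formalisation swarm, leaf prover `b2b-balaban-gan24-formalise-leaf-01`, gen 58; CT-3c under «MINE» l.31499 ∕ l.31626 ∕
l.31667; names PROVISIONAL).  HONEST FRAMING (cell contract, verbatim): «discharging `BetaPertH` makes Bałaban's UV stability UNCONDITIONAL — a real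
constructive-QFT result; it is NOT the continuum limit and NOT the Clay problem.»  HONEST DEPENDENCY (verbatim): «continuum YM on T⁴ ⇐ BetaPertH ∧ nine spine
estimates (0/9 proved); BetaPertH ⇐ (D1) ∧ (D4) ∧ CAP+tail; G-an2-4 gates asym, D1 and NE2/3/4.»

WHAT (every `N`, resp. `N = Lc^(k+1)` at `d = 3`; `B μ z := fun κ u => respStep 1 N μ z κ u`, `φ_{μ,z} := fun κ y => wΦ κ μ (y − z)`):
* §1 (generic `d`, every `N ≥ 1`) `respStep_one_eq_trans1` (`B μ z = trans1 (−N•z) (wH-column μ)`), `contourSumAdj_trans` (`𝒬ᵀ_N` commutes with coarse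
  translations: `contourSumAdj N φ κ (x − N•z) = contourSumAdj N (φ(· − z)) κ x`), **`curvAdj_curv_respStep_one_eq_contourSumAdj`**
  (`d*d (B μ z) = 𝒬ᵀ_N φ_{μ,z}` — THE TENT FORCE the owner's `StaircasePairing.abs_pairing_le_sum` is stated for), and the dressed twin
  **`curvAdj_curv_legChain_zero_eq`** (`d*d (T μ z) = d*d (B μ z)`, leaf-03's `curvAdj_curv_legAct_legChain_respStepBm` at `delta1 μ z`; every `m`).
* §2 (`d = 3`, level-uniform, source block `z` arbitrary) **`exists_partner_letters`**: ONE rate `κ₀ > 0` and constants `C_B, Φ₀, M ≥ 0` with, for ALL `k μ z`,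
  `|B μ z κ u| ≤ C_B·(Lc^{5(k+1)})⁻¹·e^{−κ₀‖quo N u − z‖∞}` (leaf-12's (N1) at `m = 0`), `|φ_{μ,z} κ y| ≤ Φ₀·(Lc^{8(k+1)})⁻¹·e^{−κ₀‖y − z‖∞}` (I1 translated),
  `|𝒬ᵀ_N φ_{μ,z} κ u| ≤ N·Φ₀·(Lc^{8(k+1)})⁻¹·e^{κ₀}·e^{−κ₀‖quo N u − z‖∞}` (`RemainderExplicitLaplacian.abs_contourSumAdj_le` translated) and
  `|d*d (B μ z) κ u| ≤ M·(Lc^{7(k+1)})⁻¹·e^{−κ₀‖quo N u − z‖∞}` (I2 translated) — ONE common rate for all four (the minimum of the suppliers' rates, envelopes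
  are monotone in the rate).
[folklore] throughout: translation bookkeeping over an5's `wH_EL'`, leaf-12's `RespStepDecay`, d4-p3's `RemainderExplicitMultiplier` ∕ `RemainderExplicitLaplacian`,
leaf-03's `RespStepBmDecompPsi` §10 BY NAME; 0 `def`, 0 cited facts, 0 `def … : Prop`, 0 sorry.  NO new estimate; discharges NOTHING of (hS, hSall) on (E);
0 wall binders; NEVER «G-an2-4 closed»; NOT D1, NOT BetaPertH, NOT continuum, NOT Clay.
-/

noncomputable section

open Finset
open scoped BigOperators
open Literature.MathematicalPhysics.QuantumFieldTheory
open Literature.MathematicalPhysics.QuantumFieldTheory.LatticeForm (quo)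
open Literature.MathematicalPhysics.QuantumFieldTheory.Balaban1983to89
open Literature.MathematicalPhysics.QuantumFieldTheory.Balaban1983to89.Beta
open B4ContourShift (supNorm supNorm_nonneg)
open AffineAveraging (Form1 Site box toSite unitVec curv curvAdj)
open AffineReproduction (contourSumAdj trans1 trans1_apply curvAdj_curv_trans1)
open KernelSpecInstance (wH wΦ)
open ResolventComposition (wH_EL')
open KKTFluctuationKernel (delta1)
open BlochFibreUniqueness (quo_add_zsmul)
open BalabanCompositeJets (respStep)
open Summit.QuantumFields.BalabanUV.Beta.GAN24.Push4Iter (LegFam legChain)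
open Summit.QuantumFields.BalabanUV.Beta.GAN24.RespStepBmDecompLegs (legAct)
open Summit.QuantumFields.BalabanUV.Beta.GAN24.RespStepBmDecompExact (respStepBmSeq)
open Summit.QuantumFields.BalabanUV.Beta.GAN24.RespStepBmDecompPsi (curvAdj_curv_legAct_legChain_respStepBm)
open Summit.QuantumFields.BalabanUV.Beta.GAN24.RespStepDecay (respStep_one exists_respStep_decay_and_grad)
open Summit.QuantumFields.BalabanUV.Beta.GAN24.UndressedResponseUnits (inv_cast_pow_pow)
open Summit.QuantumFields.BalabanUV.Beta.GAN24.DressedLegEnvelope (summable_single_and_le single_eq_delta1 legAct_delta1)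
open Summit.QuantumFields.BalabanUV.Beta.RemainderExplicitMultiplier (exists_wΦ_decay)
open Summit.QuantumFields.BalabanUV.Beta.RemainderExplicitLaplacian (exists_curvAdj_curv_wH_decay abs_contourSumAdj_le)

namespace Summit.QuantumFields.BalabanUV.Beta.GAN24.ContactPartnerLetters

variable {d : ℕ}

/-! ## §1 The undressed partner at the vertex level: translated column, translated tent force; the dressed partner's Maxwell operator -/

section Generic

variable {N : ℕ} [NeZero N]

/-- [folklore] `quo N (x − N•t) = quo N x − t`. -/
theorem quo_sub_zsmul' (x t : Site (d + 1)) : quo N (x - (N : ℤ) • t) = quo N x - t := by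
  rw [sub_eq_add_neg, ← smul_neg, quo_add_zsmul, sub_eq_add_neg]

/-- [folklore] **THE UNDRESSED ONE-SHOT LEG AT THE VERTEX LEVEL IS THE TRANSLATED MINIMISER COLUMN**: as a 1-form in the output bond,
`(κ, u) ↦ respStep 1 N μ z κ u = trans1 (−N•z) (wH-column μ) κ u` (leaf-12's `RespStepDecay.respStep_one`). -/
theorem respStep_one_eq_trans1 (μ : Fin (d + 1)) (z : Site (d + 1)) :
    (fun κ u => respStep (d := d) 1 N μ z κ u) = trans1 (-((N : ℤ) • z)) (fun κ u => wH (N := N) κ μ u) := by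
  funext κ u
  rw [respStep_one, trans1_apply, sub_eq_add_neg]

/-- [folklore] **`𝒬ᵀ_N` COMMUTES WITH COARSE TRANSLATIONS**: `contourSumAdj N φ κ (x − N•z) = contourSumAdj N (fun κ y => φ κ (y − z)) κ x`. -/
theorem contourSumAdj_sub_zsmul (φ : Form1 (d + 1) ℝ) (z : Site (d + 1)) (κ : Fin (d + 1)) (x : Site (d + 1)) :
    contourSumAdj N φ κ (x - (N : ℤ) • z) = contourSumAdj N (fun κ y => φ κ (y - z)) κ x := by
  unfold contourSumAdj
  refine Finset.sum_congr rfl fun s _ => ?_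
  have h1 : (fun i => (x - (N : ℤ) • z - (s : ℤ) • unitVec κ) i / (N : ℤ)) = quo N (x - (s : ℤ) • unitVec κ - (N : ℤ) • z) := by
    have : x - (N : ℤ) • z - (s : ℤ) • unitVec κ = x - (s : ℤ) • unitVec κ - (N : ℤ) • z := by abel
    rw [this]; rfl
  have h2 : (fun i => (x - (s : ℤ) • unitVec κ) i / (N : ℤ)) = quo N (x - (s : ℤ) • unitVec κ) := rfl
  rw [h1, h2, quo_sub_zsmul']

/-- [folklore] `trans1 (−N•z)` of the tent force is the tent force of the translated coarse form. -/
theorem trans1_contourSumAdj (φ : Form1 (d + 1) ℝ) (z : Site (d + 1)) :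
    trans1 (-((N : ℤ) • z)) (contourSumAdj N φ) = contourSumAdj N (fun κ y => φ κ (y - z)) := by
  funext κ x
  rw [trans1_apply, ← sub_eq_add_neg, contourSumAdj_sub_zsmul]

/-- NOT IN PRINT; OUR BOOKKEEPING.  **THE MAXWELL OPERATOR OF THE UNDRESSED PARTNER IS THE TRANSLATED TENT FORCE OF THE MULTIPLIER COLUMN**
(an5's gauge-free Euler–Lagrange identity `wH_EL'`, translated to the source block `z`):
`curvAdj (curv (fun κ u => respStep 1 N μ z κ u)) = contourSumAdj N (fun κ y => wΦ κ μ (y − z))` — exactly the `t = 𝒬ᵀ_N φ` of the owner's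
`StaircasePairing.abs_pairing_le_sum`, with `φ = φ_{μ,z}`. -/
theorem curvAdj_curv_respStep_one_eq_contourSumAdj (μ : Fin (d + 1)) (z : Site (d + 1)) :
    curvAdj (curv (fun κ u => respStep (d := d) 1 N μ z κ u)) = contourSumAdj N (fun κ y => wΦ (N := N) κ μ (y - z)) := by
  rw [respStep_one_eq_trans1, curvAdj_curv_trans1, ← trans1_contourSumAdj]
  congr 1
  funext κ x
  exact wH_EL' μ κ x

/-- [folklore] Entry form of the same: `curvAdj (curv (B μ z)) b x = curvAdj (curv (wH-column μ)) b (x − N•z)`. -/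
theorem curvAdj_curv_respStep_one_apply (μ : Fin (d + 1)) (z : Site (d + 1)) (b : Fin (d + 1)) (x : Site (d + 1)) :
    curvAdj (curv (fun κ u => respStep (d := d) 1 N μ z κ u)) b x = curvAdj (curv (fun κ u => wH (N := N) κ μ u)) b (x - (N : ℤ) • z) := by
  rw [respStep_one_eq_trans1, curvAdj_curv_trans1, trans1_apply, sub_eq_add_neg]

end Generic

section Dressed

variable {Lc : ℕ} [NeZero Lc]

/-- NOT IN PRINT; OUR BOOKKEEPING.  **THE DRESSED PARTNER HAS THE MAXWELL OPERATOR OF THE UNDRESSED ONE** (leaf-03 g51's §10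
`curvAdj_curv_legAct_legChain_respStepBm` at the point datum `delta1 μ z`; every `m k`; in-block root): as 1-forms in the output bond,
`curvAdj (curv (legChain (respStepBmSeq ρ Lc) m k μ z)) = curvAdj (curv (respStep (Lc^m) (Lc^(m+k+1)) μ z))`. -/
theorem curvAdj_curv_legChain_eq {rr : Fin (d + 1) → ℕ} (hrr : rr ∈ box (d + 1) Lc) (m k : ℕ) (μ : Fin (d + 1)) (z : Site (d + 1)) :
    curvAdj (curv (legChain (respStepBmSeq (d := d) (toSite rr) Lc) m k μ z))
      = curvAdj (curv (respStep (d := d) (Lc ^ m) (Lc ^ (m + k + 1)) μ z)) := by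
  have hb : ∀ μ', Summable (delta1 (d := d) μ z μ') := by
    intro μ'
    have h := (summable_single_and_le (d := d) μ z).1 μ'
    rw [single_eq_delta1] at h
    exact h
  have e1 : legAct (legChain (respStepBmSeq (d := d) (toSite rr) Lc) m k) (delta1 μ z) = legChain (respStepBmSeq (d := d) (toSite rr) Lc) m k μ z := by
    funext κ u; exact legAct_delta1 _ μ z κ u
  have e2 : legAct (respStep (d := d) (Lc ^ m) (Lc ^ (m + k + 1))) (delta1 μ z) = respStep (d := d) (Lc ^ m) (Lc ^ (m + k + 1)) μ z := by
    funext κ u; exact legAct_delta1 _ μ z κ u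
  rw [← e1, ← e2]
  exact curvAdj_curv_legAct_legChain_respStepBm hrr m k hb

/-- [folklore] At the vertex level `m = 0` the undressed member is the one-shot leg `respStep 1 (Lc^(k+1))` (`Lc^0 = 1`, `0 + k + 1 = k + 1`). -/
theorem respStep_pow_zero (k : ℕ) : respStep (d := d) (Lc ^ 0) (Lc ^ (0 + k + 1)) = respStep (d := d) 1 (Lc ^ (k + 1)) := by
  rw [pow_zero, Nat.zero_add]

end Dressed

/-! ## §2 `d = 3`: the level-uniform partner letters at an arbitrary source block -/

section Four

variable {Lc : ℕ} [NeZero Lc]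

/-- NOT IN PRINT; OUR BOOKKEEPING.  **THE FOUR PARTNER LETTERS OF THE UNDRESSED ONE-SHOT LEG AT THE VERTEX LEVEL, ONE COMMON RATE** (`d = 3`; every `k`,
every source bond `(μ, z)`; `N = Lc^(k+1)`, `B μ z = (κ,u) ↦ respStep 1 N μ z κ u`, `φ_{μ,z} = (κ,y) ↦ wΦ κ μ (y − z)`): `∃ κ₀ > 0, C_B Φ₀ M ≥ 0` with
(i) `|B μ z κ u| ≤ C_B·(Lc^{5(k+1)})⁻¹·e^{−κ₀‖quo N u − z‖∞}` (leaf-12's (N1), `m = 0`);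
(ii) `|φ_{μ,z} κ y| ≤ Φ₀·(Lc^{8(k+1)})⁻¹·e^{−κ₀‖y − z‖∞}` (d4-p3's I1 `exists_wΦ_decay`, translated);
(iii) `|contourSumAdj N φ_{μ,z} κ u| ≤ N·Φ₀·(Lc^{8(k+1)})⁻¹·e^{κ₀}·e^{−κ₀‖quo N u − z‖∞}` (`abs_contourSumAdj_le`, translated);
(iv) `|curvAdj (curv (B μ z)) κ u| ≤ M·(Lc^{7(k+1)})⁻¹·e^{−κ₀‖quo N u − z‖∞}` (d4-p3's I2 `exists_curvAdj_curv_wH_decay`, translated).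
ONE rate: the minimum of the two suppliers' rates (envelopes decrease in the rate). -/
theorem exists_partner_letters :
    ∃ κ₀ CB Φ₀ M : ℝ, 0 < κ₀ ∧ 0 ≤ CB ∧ 0 ≤ Φ₀ ∧ 0 ≤ M ∧
      (∀ (k : ℕ) (μ : Fin (3 + 1)) (z : Site (3 + 1)) (κ : Fin (3 + 1)) (u : Site (3 + 1)),
        |respStep (d := 3) 1 (Lc ^ (k + 1)) μ z κ u|
          ≤ CB * ((Lc : ℝ) ^ (5 * (k + 1)))⁻¹ * Real.exp (-(κ₀ * supNorm (quo (Lc ^ (k + 1)) u - z)))) ∧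
      (∀ (k : ℕ) (μ : Fin (3 + 1)) (z : Site (3 + 1)) (κ : Fin (3 + 1)) (y : Site (3 + 1)),
        |wΦ (N := Lc ^ (k + 1)) κ μ (y - z)| ≤ Φ₀ * ((Lc : ℝ) ^ (8 * (k + 1)))⁻¹ * Real.exp (-(κ₀ * supNorm (y - z)))) ∧
      (∀ (k : ℕ) (μ : Fin (3 + 1)) (z : Site (3 + 1)) (κ : Fin (3 + 1)) (u : Site (3 + 1)),
        |contourSumAdj (Lc ^ (k + 1)) (fun κ y => wΦ (N := Lc ^ (k + 1)) κ μ (y - z)) κ u|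
          ≤ (Lc ^ (k + 1) : ℕ) * (Φ₀ * ((Lc : ℝ) ^ (8 * (k + 1)))⁻¹) * Real.exp κ₀ *
            Real.exp (-(κ₀ * supNorm (quo (Lc ^ (k + 1)) u - z)))) ∧
      (∀ (k : ℕ) (μ : Fin (3 + 1)) (z : Site (3 + 1)) (κ : Fin (3 + 1)) (u : Site (3 + 1)),
        |curvAdj (curv (fun κ' u' => respStep (d := 3) 1 (Lc ^ (k + 1)) μ z κ' u')) κ u|
          ≤ M * ((Lc : ℝ) ^ (7 * (k + 1)))⁻¹ * Real.exp (-(κ₀ * supNorm (quo (Lc ^ (k + 1)) u - z)))) := by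
  obtain ⟨κ₁, C, -, hκ₁, hC, -, hN1, -⟩ := exists_respStep_decay_and_grad (Lc := Lc)
  obtain ⟨κ₂, Φ, hκ₂, hΦ, hI1⟩ := exists_wΦ_decay (Lc := Lc)
  obtain ⟨κ₃, M, hκ₃, hM, hI2⟩ := exists_curvAdj_curv_wH_decay (Lc := Lc)
  -- one common rate
  set κ₀ : ℝ := min κ₁ (min κ₂ κ₃) with hκ₀
  have h01 : κ₀ ≤ κ₁ := min_le_left _ _
  have h02 : κ₀ ≤ κ₂ := (min_le_right _ _).trans (min_le_left _ _)
  have h03 : κ₀ ≤ κ₃ := (min_le_right _ _).trans (min_le_right _ _)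
  have hκ₀pos : 0 < κ₀ := lt_min hκ₁ (lt_min hκ₂ hκ₃)
  have mono : ∀ {κ κ' : ℝ} (s : ℝ), κ ≤ κ' → 0 ≤ s → Real.exp (-(κ' * s)) ≤ Real.exp (-(κ * s)) :=
    fun s h hs => Real.exp_le_exp.2 (by nlinarith)
  have hL : (0 : ℝ) < Lc := by exact_mod_cast Nat.pos_of_ne_zero (NeZero.ne Lc)
  refine ⟨κ₀, C, Φ, M, hκ₀pos, hC, hΦ, hM, fun k μ z κ u => ?_, fun k μ z κ y => ?_, fun k μ z κ u => ?_, fun k μ z κ u => ?_⟩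
  · -- (i) leaf-12's (N1) at m = 0
    have h := hN1 0 k μ z κ u
    rw [pow_zero, Nat.zero_add, inv_cast_pow_pow] at h
    refine h.trans (mul_le_mul_of_nonneg_left (mono _ h01 (supNorm_nonneg _)) (by positivity))
  · -- (ii) I1 translated
    have h := hI1 k κ μ (y - z)
    rw [inv_cast_pow_pow, inv_cast_pow_pow] at h
    have e : C * 0 = 0 := mul_zero C
    calc |wΦ (N := Lc ^ (k + 1)) κ μ (y - z)|
        ≤ Φ * ((Lc : ℝ) ^ (5 * (k + 1)))⁻¹ * ((Lc : ℝ) ^ (3 * (k + 1)))⁻¹ * Real.exp (-(κ₂ * supNorm (y - z))) := h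
      _ = Φ * ((Lc : ℝ) ^ (8 * (k + 1)))⁻¹ * Real.exp (-(κ₂ * supNorm (y - z))) := by
          rw [show 8 * (k + 1) = 5 * (k + 1) + 3 * (k + 1) by ring, pow_add, mul_inv]; ring
      _ ≤ Φ * ((Lc : ℝ) ^ (8 * (k + 1)))⁻¹ * Real.exp (-(κ₀ * supNorm (y - z))) :=
          mul_le_mul_of_nonneg_left (mono _ h02 (supNorm_nonneg _)) (by positivity)
  · -- (iii) the tent force of the translated column
    haveI : NeZero (Lc ^ (k + 1)) := ⟨pow_ne_zero _ (NeZero.ne Lc)⟩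
    have hNpos : 0 < Lc ^ (k + 1) := pow_pos (Nat.pos_of_ne_zero (NeZero.ne Lc)) _
    have hφ : ∀ κ' y, |(fun κ' y => wΦ (N := Lc ^ (k + 1)) κ' μ (y - z)) κ' y|
        ≤ Φ * ((Lc : ℝ) ^ (8 * (k + 1)))⁻¹ * Real.exp (-(κ₀ * supNorm (y - z))) := by
      intro κ' y
      have h := hI1 k κ' μ (y - z)
      rw [inv_cast_pow_pow, inv_cast_pow_pow] at h
      calc |wΦ (N := Lc ^ (k + 1)) κ' μ (y - z)|
          ≤ Φ * ((Lc : ℝ) ^ (5 * (k + 1)))⁻¹ * ((Lc : ℝ) ^ (3 * (k + 1)))⁻¹ * Real.exp (-(κ₂ * supNorm (y - z))) := h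
        _ = Φ * ((Lc : ℝ) ^ (8 * (k + 1)))⁻¹ * Real.exp (-(κ₂ * supNorm (y - z))) := by
            rw [show 8 * (k + 1) = 5 * (k + 1) + 3 * (k + 1) by ring, pow_add, mul_inv]; ring
        _ ≤ Φ * ((Lc : ℝ) ^ (8 * (k + 1)))⁻¹ * Real.exp (-(κ₀ * supNorm (y - z))) :=
            mul_le_mul_of_nonneg_left (mono _ h02 (supNorm_nonneg _)) (by positivity)
    -- translate: the envelope about `z` is the envelope about `0` of the form translated by `N•z`
    have h := abs_contourSumAdj_le (d := 3) hNpos (φ := fun κ' y => wΦ (N := Lc ^ (k + 1)) κ' μ (y + z - z))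
      (B := Φ * ((Lc : ℝ) ^ (8 * (k + 1)))⁻¹) (κ₀ := κ₀) (by positivity) hκ₀pos.le
      (fun κ' y => by have h' := hφ κ' (y + z); simp only [add_sub_cancel_right] at h' ⊢; exact h') κ (u - ((Lc ^ (k + 1) : ℕ) : ℤ) • z)
    rw [contourSumAdj_sub_zsmul, quo_sub_zsmul'] at h
    have e : (fun κ' y => (fun κ' y => wΦ (N := Lc ^ (k + 1)) κ' μ (y + z - z)) κ' (y - z))
        = fun κ' y => wΦ (N := Lc ^ (k + 1)) κ' μ (y - z) := by
      funext κ' y; simp only [sub_add_cancel]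
    rw [e] at h
    exact h
  · -- (iv) I2 translated
    haveI : NeZero (Lc ^ (k + 1)) := ⟨pow_ne_zero _ (NeZero.ne Lc)⟩
    rw [curvAdj_curv_respStep_one_apply]
    have h := hI2 k μ κ (u - ((Lc ^ (k + 1) : ℕ) : ℤ) • z)
    rw [inv_cast_pow_pow, inv_cast_pow_pow, quo_sub_zsmul'] at h
    calc |curvAdj (curv (fun κ' u' => wH (N := Lc ^ (k + 1)) κ' μ u')) κ (u - ((Lc ^ (k + 1) : ℕ) : ℤ) • z)|
        ≤ M * ((Lc : ℝ) ^ (5 * (k + 1)))⁻¹ * ((Lc : ℝ) ^ (2 * (k + 1)))⁻¹ * Real.exp (-(κ₃ * supNorm (quo (Lc ^ (k + 1)) u - z))) := h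
      _ = M * ((Lc : ℝ) ^ (7 * (k + 1)))⁻¹ * Real.exp (-(κ₃ * supNorm (quo (Lc ^ (k + 1)) u - z))) := by
          have e7 : ((Lc : ℝ) ^ (7 * (k + 1)))⁻¹ = ((Lc : ℝ) ^ (5 * (k + 1)))⁻¹ * ((Lc : ℝ) ^ (2 * (k + 1)))⁻¹ := by
            rw [← mul_inv, ← pow_add]; congr 2; ring
          rw [e7]; ring
      _ ≤ M * ((Lc : ℝ) ^ (7 * (k + 1)))⁻¹ * Real.exp (-(κ₀ * supNorm (quo (Lc ^ (k + 1)) u - z))) :=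
          mul_le_mul_of_nonneg_left (mono _ h03 (supNorm_nonneg _)) (by positivity)

end Four

end Summit.QuantumFields.BalabanUV.Beta.GAN24.ContactPartnerLetters

end
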